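import Mathlib
import Summits.PneNP.PneNP.Theses.ConvexRankGates
import Summits.PneNP.PneNP.Theorems.ConvexRankGatesConvexGateBlindSingleGate
import Summits.PneNP.PneNP.Theorems.ConvexRankGatesConvexGateBlindCertificates

/-!
# PneNP / ConvexRankGates — `ConvexGateBlind` in certificate form

Helper (`--supports stmt-PneNP-10680`). Combining the single-gate collapse
(`convexGateBlind_of_singleGate`, `singleGate_of_convexGateBlind`) with the Farkas lemma for
trace-bounded semidefinite programmes (`certificate_of_infeasible_traceBounded`) and the free trace
bound (`conv_exists_traceBound`): the crux `ConvexGateBlind` is EQUIVALENT to the non-existence,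
for every `c` and all large `m`, of data `(A, b, B ≥ 0, R > 0)` with `p + q ≤ m^c` such that every
input with a `⌈m^δ⌉₊`-clique has a trace-`≤ R` PSD witness and every clique-free input has a
non-negative dual certificate (`convexGateBlind_iff_certificateBlind`). This is the exact statement a
psd-rank / certificate-counting lower bound (the route's intended method: positives = bare cliques,
negatives = dense random graphs, one certificate rejects few negatives) has to establish.
-/

namespace Summit.PneNP.PneNP.Theorems

open Matrix Finset

/-! ### The crux in certificate form -/

section certificateForm

open Literature.Computability.Complexity Filter
open scoped Classical

/-- Appending the trace row `tr Y ≤ R` to a CONV programme: rows `Fin (p+1)` via `Fin.snoc`. [folklore] -/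
theorem conv_snoc_traceRow_iff {ι : Type*} [Fintype ι] {p q : ℕ} (A : Fin p → Matrix (Fin q) (Fin q) ℝ)
    (b : Fin p → ℝ) (B : Fin p → ι → ℝ) (R : ℝ) (x : ι → Bool) (Y : Matrix (Fin q) (Fin q) ℝ) :
    (∀ i : Fin (p + 1), ((Fin.snoc A 1 : Fin (p + 1) → Matrix (Fin q) (Fin q) ℝ) i * Y).trace ≤
        (Fin.snoc b R : Fin (p + 1) → ℝ) i +
          ∑ e, (Fin.snoc B 0 : Fin (p + 1) → ι → ℝ) i e * (if x e then (1 : ℝ) else 0)) ↔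
      (Y.trace ≤ R ∧ ∀ i : Fin p, (A i * Y).trace ≤ b i + ∑ e, B i e * (if x e then (1 : ℝ) else 0)) := by
  rw [Fin.forall_fin_succ']
  simp only [Fin.snoc_castSucc, Fin.snoc_last, Matrix.one_mul, Pi.zero_apply, zero_mul,
    Finset.sum_const_zero, add_zero]
  exact and_comm

/-- **Certificate form of the crux.** `ConvexGateBlind` is EQUIVALENT to: for some `δ ∈ (0, 1/2)` and
every `c`, eventually in `m`, there are NO data `(A, b, B ≥ 0)` with `p + q ≤ m^c` and `R > 0` such
that (i) every input containing a `⌈m^δ⌉₊`-clique has a PSD witness of trace `≤ R`, and (ii) every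
clique-free input `x` has a FARKAS CERTIFICATE `y ≥ 0`, `λ ≥ 0` — non-negative on the PSD cone
(`∑ yᵢ tr(Aᵢ Y) + λ tr Y ≥ 0`) and negative at `x`'s right-hand side (`∑ yᵢ (bᵢ + (B 𝟙ₓ)ᵢ) + λ R < 0`).
(`→`: such data IS a single CONV gate with the trace row appended, computing CLIQUE by weak
duality; `←`: a single gate computing CLIQUE has a free trace bound and, by the Farkas lemma for
trace-bounded programmes, certificates on every rejected input.) This is the form the route's
intended lower-bound method starts from (each certificate is a non-negative weighting). [folklore] -/
theorem convexGateBlind_iff_certificateBlind :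
    Summit.PneNP.PneNP.Theses.ConvexRankGates.ConvexGateBlind ↔
    ∃ δ : ℝ, 0 < δ ∧ δ < 1 / 2 ∧ ∀ c : ℕ, ∀ᶠ m : ℕ in atTop, ∀ (p q : ℕ), p + q ≤ m ^ c →
      ∀ (A : Fin p → Matrix (Fin q) (Fin q) ℝ) (b : Fin p → ℝ)
        (B : Fin p → (⊤ : SimpleGraph (Fin m)).edgeSet → ℝ), (∀ i e, 0 ≤ B i e) → ∀ R : ℝ, 0 < R →
        ¬ ((∀ x : (⊤ : SimpleGraph (Fin m)).edgeSet → Bool,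
              decide (¬ (SimpleGraph.fromEdgeSet {e : Sym2 (Fin m) |
                ∃ h : e ∈ (⊤ : SimpleGraph (Fin m)).edgeSet, x ⟨e, h⟩ = true}).CliqueFree
                  ⌈(m : ℝ) ^ δ⌉₊) = true →
              ∃ Y : Matrix (Fin q) (Fin q) ℝ, Y.PosSemidef ∧ Y.trace ≤ R ∧
                ∀ i, (A i * Y).trace ≤ b i + ∑ e, B i e * (if x e then (1 : ℝ) else 0)) ∧
           (∀ x : (⊤ : SimpleGraph (Fin m)).edgeSet → Bool,
              decide (¬ (SimpleGraph.fromEdgeSet {e : Sym2 (Fin m) |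
                ∃ h : e ∈ (⊤ : SimpleGraph (Fin m)).edgeSet, x ⟨e, h⟩ = true}).CliqueFree
                  ⌈(m : ℝ) ^ δ⌉₊) = false →
              ∃ (y : Fin p → ℝ) (lam : ℝ), (∀ i, 0 ≤ y i) ∧ 0 ≤ lam ∧
                (∀ Y : Matrix (Fin q) (Fin q) ℝ, Y.PosSemidef →
                  0 ≤ ∑ i, y i * (A i * Y).trace + lam * Y.trace) ∧
                ∑ i, y i * (b i + ∑ e, B i e * (if x e then (1 : ℝ) else 0)) + lam * R < 0)) := by
  constructor
  · -- (→) via the single-gate form, appending the trace row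
    intro h
    obtain ⟨δ, hδ0, hδ1, hblind⟩ := singleGate_of_convexGateBlind h
    refine ⟨δ, hδ0, hδ1, fun c => ?_⟩
    filter_upwards [hblind (c + 1), eventually_ge_atTop 2] with m hm hm2 p q hpq A b B hB R hR
    rintro ⟨hacc, hrej⟩
    refine hm (p + 1) q ?_ (Fin.snoc A 1) (Fin.snoc b R) (Fin.snoc B 0) ?_ ?_
    · have : m ^ c + 1 ≤ m ^ (c + 1) := by
        rw [pow_succ]
        have := Nat.one_le_pow c m (by omega)
        nlinarith
      omega
    · intro i e
      refine Fin.lastCases ?_ (fun j => ?_) i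
      · simp
      · simpa using hB j e
    · intro x
      constructor
      · intro hx
        obtain ⟨Y, hY, htr, hrows⟩ := hacc x hx
        exact ⟨Y, hY, (conv_snoc_traceRow_iff A b B R x Y).2 ⟨htr, hrows⟩⟩
      · rintro ⟨Y, hY, hrows⟩
        rw [conv_snoc_traceRow_iff] at hrows
        by_contra hx
        obtain ⟨y, lam, hy, hlam, hpsd, hneg⟩ := hrej x (by simpa using hx)
        exact infeasible_of_certificate A _ R y lam hy hlam hpsd hneg ⟨Y, hY, hrows.1, hrows.2⟩
  · -- (←) a single gate computing CLIQUE has a free trace bound and Farkas certificates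
    intro h
    apply convexGateBlind_of_singleGate
    obtain ⟨δ, hδ0, hδ1, hcert⟩ := h
    refine ⟨δ, hδ0, hδ1, fun c => ?_⟩
    filter_upwards [hcert c] with m hm p q hpq A b B hB hgate
    obtain ⟨R, hR, hiff⟩ := conv_exists_traceBound A
      (fun x i => b i + ∑ e, B i e * (if x e then (1 : ℝ) else 0))
    refine hm p q hpq A b B hB R hR ⟨fun x hx => ?_, fun x hx => ?_⟩
    · exact (hiff x).1 ((hgate x).1 hx)
    · refine certificate_of_infeasible_traceBounded A _ hR fun hfeas => ?_
      have := (hgate x).2 ((hiff x).2 hfeas)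
      rw [hx] at this
      exact Bool.false_ne_true this

/-- **Separator form of a certificate.** If `(y, λ)` is a Farkas certificate at the rejected input `x`
(`∑ yᵢ (bᵢ + (B 𝟙ₓ)ᵢ) + λ R < 0`, non-negative on the PSD cone) and the input `u` is accepted with a
trace-`≤ R` witness, then the NON-NEGATIVE weighting `c = Bᵀ y` (`cₑ = ∑ᵢ yᵢ Bᵢₑ ≥ 0` when `B, y ≥ 0`)
strictly separates them: `c · 𝟙ₓ < c · 𝟙ᵤ`. So every rejection of a trace-normalised CONV gate is a
non-negative linear threshold cutting the rejected input off from ALL accepted inputs — the object the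
route's per-certificate counting (Markov over dense random negatives) is about. [folklore] -/
theorem separator_of_certificate {ι : Type*} [Fintype ι] {p q : ℕ}
    (A : Fin p → Matrix (Fin q) (Fin q) ℝ) (b : Fin p → ℝ) (B : Fin p → ι → ℝ) (R : ℝ)
    (y : Fin p → ℝ) (lam : ℝ) (hy : ∀ i, 0 ≤ y i) (hlam : 0 ≤ lam)
    (hpsd : ∀ Y : Matrix (Fin q) (Fin q) ℝ, Y.PosSemidef →
      0 ≤ ∑ i, y i * (A i * Y).trace + lam * Y.trace)
    (x : ι → Bool) (hneg : ∑ i, y i * (b i + ∑ e, B i e * (if x e then (1 : ℝ) else 0)) + lam * R < 0)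
    (u : ι → Bool) (hu : ∃ Y : Matrix (Fin q) (Fin q) ℝ, Y.PosSemidef ∧ Y.trace ≤ R ∧
      ∀ i, (A i * Y).trace ≤ b i + ∑ e, B i e * (if u e then (1 : ℝ) else 0)) :
    ∑ e, (∑ i, y i * B i e) * (if x e then (1 : ℝ) else 0) <
      ∑ e, (∑ i, y i * B i e) * (if u e then (1 : ℝ) else 0) := by
  obtain ⟨Y, hY, htr, hrows⟩ := hu
  have h0 := hpsd Y hY
  have h1 : ∑ i, y i * (A i * Y).trace ≤ ∑ i, y i * (b i + ∑ e, B i e * (if u e then (1 : ℝ) else 0)) :=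
    Finset.sum_le_sum fun i _ => mul_le_mul_of_nonneg_left (hrows i) (hy i)
  have h2 : lam * Y.trace ≤ lam * R := mul_le_mul_of_nonneg_left htr hlam
  -- swap the double sums
  have hswap : ∀ v : ι → Bool, ∑ i, y i * (b i + ∑ e, B i e * (if v e then (1 : ℝ) else 0)) =
      ∑ i, y i * b i + ∑ e, (∑ i, y i * B i e) * (if v e then (1 : ℝ) else 0) := by
    intro v
    simp only [mul_add, Finset.sum_add_distrib, Finset.mul_sum, Finset.sum_mul]
    congr 1
    rw [Finset.sum_comm]
    exact Finset.sum_congr rfl fun e _ => Finset.sum_congr rfl fun i _ => by ring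
  rw [hswap] at hneg h1
  linarith

end certificateForm

end Summit.PneNP.PneNP.Theorems
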